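import Summits.HodgeConjecture.HodgeConjecture.Theses.EndoscopicMiddleDegree
import Literature.AlgebraicGeometry.HodgeTheory.ComplexGysinCorrespondence
import Literature.AlgebraicGeometry.HodgeTheory.MotivatedClassesAlgebraic
import Literature.AlgebraicGeometry.HodgeTheory.GysinKernelProofs

/-!
# `IsotypicMiddleClassesAlgebraic` (stmt-HodgeConjecture-14301) · Negative · load-bearing hypotheses

Negative knowledge for the crux `EndoscopicMiddleDegree.IsotypicMiddleClassesAlgebraic` (route
EndoscopicMiddleDegree, rank 3): WHICH hypotheses on the correspondence action
`P_γ = corrAction μ hX hX rfl γ = pr₁₊(pr₂^* – ∪ γ)` carry weight. (a) WITHOUT the `(n,n)`-image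
hypothesis H3 the statement says that EVERY rational class in the middle degree of the sector is
algebraic (`mem_algebraicClasses_of_withoutHodgeImage`): the diagonal class `[Δ_X] = (𝟙,𝟙)_* 1` is
algebraic (`complexGysin_graph_one_mem_algebraicClasses`) and acts as the identity
(`corrAction_diagonal_apply`, from the tree's `corrClassAction_graph`), trivially preserving rational
classes — false at every level with `h^{2n,0}(X_K) ≠ 0`. (b) WITHOUT `P c = c` the same collapse
(`mem_algebraicClasses_of_withoutFixed`, `γ = 0`), given a Hodge model. (c) Conversely the other
hypotheses — Poincaré duality of `μ` (a theorem for every `μ`: `OrientationFamily.hasPoincareDuality`),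
`γ ∈ algebraicClasses`, rationality preservation H2 and `1 ≤ m ≤ 2` — are logically idle: the
statement stripped of all four is still a consequence of the Hodge conjecture
(`not_hodgeConjecture_of_not_stripped`), so no `_false_without_` witness for them exists short of
`¬HC`. Disprover's work file: `Cruxes/IsotypicMiddleClassesAlgebraic/Disproof.lean` (F3).
Refuter seat refuter-cdisprove-stmt-HodgeConjecture-14301-0 (cdisprove cycle 1), 2026-08-16.
-/

noncomputable section

-- The mandated namespace `Summit.<P>.<Sub>.Theorems.…` repeats `HodgeConjecture` (single-conjunct summit).
set_option linter.dupNamespace false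

namespace Summit.HodgeConjecture.HodgeConjecture.Theorems.IsotypicMiddleClassesAlgebraic.Negative.LoadBearing

open CategoryTheory MonoidalCategory CartesianMonoidalCategory
open Literature.AlgebraicGeometry Literature.AlgebraicGeometry.HodgeTheory
  Literature.AlgebraicGeometry.ShimuraVarieties Literature.AlgebraicTopology.SingularHomology
open Summit.HodgeConjecture.HodgeConjecture.Theses.EndoscopicMiddleDegree (IsotypicMiddleClassesAlgebraic)

variable {m n : ℕ} {X : Motives.SchemeOver ℂ}

/-- **`[Δ_X]_* = id`.** The correspondence action `corrAction μ hX hX rfl` of the diagonal class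
`[Δ_X] := (𝟙, 𝟙)_* 1 ∈ H^{2n}((X ⊗ X)(ℂ); ℂ)` is the identity of `Hᵃ(X(ℂ); ℂ)`, `a ≤ 2 dim X`
(`corrClassAction_graph` at `f = 𝟙 X`: projection formula, `(𝟙,𝟙) ≫ pr₁ = 𝟙`, `(𝟙)_* = id`).
[cite: VoisinHodgeII2003, proof of Thm. 10.17 (10.7)] [cite: FultonYoungTableaux1997, Appendix B §B.1 (2), (5), (6)] -/
theorem corrAction_diagonal_apply (μ : OrientationFamily) (hX : Motives.IsSmoothProjective n X) {a : ℕ}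
    (ha : a ≤ 2 * n) (c : complexBetti X a) :
    corrAction μ hX hX (rfl : a + 2 * n = a + 2 * n)
      (complexGysin μ hX (Motives.IsSmoothProjective.tensor_holds hX hX) (lift (𝟙 X) (𝟙 X))
        (show 0 + 2 * (n + n) = 2 * n + 2 * n by omega)
        (singularCohomology.one ℂ (Motives.ComplexPoints X))) c = c := by
  have hq : a + (2 * n - a) = 2 * n := by omega
  rw [corrAction_eq_corrClassAction μ hX hX rfl hq]
  have h := corrClassAction_graph μ μ.hasPoincareDuality hX
    (Motives.IsSmoothProjective.tensor_holds hX hX) (𝟙 X) hq c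
  rw [complexBetti.map_id] at h
  exact h

/-- **(a) Without H3 the crux asserts that every rational middle class is algebraic.** If the crux's
conclusion held for every algebraic `γ` whose action preserves rational classes — WITHOUT asking the
image of `P_γ` to be of type `(n,n)` — then every rational class in `H^{2(m+1)}(X(ℂ); ℂ)` of the
sector would be algebraic (witness `γ = [Δ_X]`, `P = id`). [cite: VoisinHodgeII2003, proof of Thm. 10.17 (10.7)] -/
theorem mem_algebraicClasses_of_withoutHodgeImage
    (h : ∀ (μ : OrientationFamily), μ.HasPoincareDuality → ∀ (m : ℕ) (X : Motives.SchemeOver ℂ)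
      (D : UnitaryBallQuotientDatum (2 * (m + 1)) X), 1 ≤ m → m ≤ 2 →
      ∀ γ ∈ algebraicClasses (X ⊗ X) (2 * (m + 1)),
        (∀ β, IsRationalClass β → IsRationalClass
          (corrAction μ D.isSmoothProjective D.isSmoothProjective
            (rfl : 2 * (m + 1) + 2 * (2 * (m + 1)) = 2 * (m + 1) + 2 * (2 * (m + 1))) γ β)) →
        ∀ c, IsRationalClass c →
          corrAction μ D.isSmoothProjective D.isSmoothProjective
            (rfl : 2 * (m + 1) + 2 * (2 * (m + 1)) = 2 * (m + 1) + 2 * (2 * (m + 1))) γ c = c →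
          c ∈ algebraicClasses X (m + 1))
    (m : ℕ) (X : Motives.SchemeOver ℂ) (D : UnitaryBallQuotientDatum (2 * (m + 1)) X) (h1 : 1 ≤ m)
    (h2 : m ≤ 2) (c : complexBetti X (2 * (m + 1))) (hc : IsRationalClass c) :
    c ∈ algebraicClasses X (m + 1) := by
  set μ : OrientationFamily := fun _ _ h ↦ Classical.choice (Motives.ComplexPoints.isOrientableOver ℂ h)
  have hX := D.isSmoothProjective
  refine h μ μ.hasPoincareDuality m X D h1 h2 _
    (complexGysin_graph_one_mem_algebraicClasses μ μ.hasPoincareDuality hX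
      (Motives.IsSmoothProjective.tensor_holds hX hX) (𝟙 X)) (fun β hβ ↦ ?_) c hc ?_
  · rwa [corrAction_diagonal_apply μ hX (by omega)]
  · rw [corrAction_diagonal_apply μ hX (by omega)]

/-- **(b) Without `P c = c` the crux asserts that every rational middle class is algebraic** (witness
`γ = 0`, `P = 0`, which preserves rational classes and has `(n,n)` values as soon as a Hodge model
exists). [cite: Deligne2000, §1] -/
theorem mem_algebraicClasses_of_withoutFixed
    (h : ∀ (μ : OrientationFamily), μ.HasPoincareDuality → ∀ (m : ℕ) (X : Motives.SchemeOver ℂ)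
      (D : UnitaryBallQuotientDatum (2 * (m + 1)) X), 1 ≤ m → m ≤ 2 →
      ∀ γ ∈ algebraicClasses (X ⊗ X) (2 * (m + 1)),
        (∀ β, IsRationalClass β → IsRationalClass
          (corrAction μ D.isSmoothProjective D.isSmoothProjective
            (rfl : 2 * (m + 1) + 2 * (2 * (m + 1)) = 2 * (m + 1) + 2 * (2 * (m + 1))) γ β)) →
        (∀ β, IsOfHodgeType (2 * (m + 1)) X (2 * (m + 1)) (m + 1) (m + 1)
          (corrAction μ D.isSmoothProjective D.isSmoothProjective
            (rfl : 2 * (m + 1) + 2 * (2 * (m + 1)) = 2 * (m + 1) + 2 * (2 * (m + 1))) γ β)) →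
        ∀ c, IsRationalClass c → c ∈ algebraicClasses X (m + 1))
    (m : ℕ) (X : Motives.SchemeOver ℂ) (D : UnitaryBallQuotientDatum (2 * (m + 1)) X)
    (A : HodgeModel (2 * (m + 1)) X) (h1 : 1 ≤ m) (h2 : m ≤ 2) (c : complexBetti X (2 * (m + 1)))
    (hc : IsRationalClass c) : c ∈ algebraicClasses X (m + 1) := by
  set μ : OrientationFamily := fun _ _ h ↦ Classical.choice (Motives.ComplexPoints.isOrientableOver ℂ h)
  have h0 : corrAction μ D.isSmoothProjective D.isSmoothProjective
      (rfl : 2 * (m + 1) + 2 * (2 * (m + 1)) = 2 * (m + 1) + 2 * (2 * (m + 1)))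
      (0 : complexBetti (X ⊗ X) (2 * (2 * (m + 1)))) = 0 := map_zero _
  refine h μ μ.hasPoincareDuality m X D h1 h2 0 (Submodule.zero_mem _) (fun β _ ↦ ?_) (fun β ↦ ?_) c hc
  · rw [h0, LinearMap.zero_apply]; exact IsRationalClass.zero
  · rw [h0, LinearMap.zero_apply]; exact IsOfHodgeType.zero A _ _ _

/-- **(c) The STRIPPED crux is still a consequence of HC.** Drop Poincaré duality of `μ`, the bounds on
`m`, algebraicity of `γ` and rationality preservation all at once: if the resulting (much stronger)
statement fails, the Hodge conjecture fails. Hence none of these four hypotheses admits a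
`_false_without_` witness short of `¬HC`. [cite: Deligne2000, §1] -/
theorem not_hodgeConjecture_of_not_stripped
    (h : ¬ ∀ (μ : OrientationFamily) (m : ℕ) (X : Motives.SchemeOver ℂ)
      (D : UnitaryBallQuotientDatum (2 * (m + 1)) X) (γ : complexBetti (X ⊗ X) (2 * (2 * (m + 1)))),
      (∀ β, IsOfHodgeType (2 * (m + 1)) X (2 * (m + 1)) (m + 1) (m + 1)
        (corrAction μ D.isSmoothProjective D.isSmoothProjective
          (rfl : 2 * (m + 1) + 2 * (2 * (m + 1)) = 2 * (m + 1) + 2 * (2 * (m + 1))) γ β)) →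
      ∀ c, IsRationalClass c →
        corrAction μ D.isSmoothProjective D.isSmoothProjective
          (rfl : 2 * (m + 1) + 2 * (2 * (m + 1)) = 2 * (m + 1) + 2 * (2 * (m + 1))) γ c = c →
        c ∈ algebraicClasses X (m + 1)) :
    ¬ _root_.HodgeConjecture := by
  intro hHC
  exact h fun μ m X D γ hP c hc hPc ↦ (hHC D.isSmoothProjective).2 (m + 1) c hc (hPc ▸ hP c)

/-- … while the stripped statement implies the crux, which is thus bracketed between two consequences
of HC. (Stated as: if the crux fails, the stripped statement fails.) [folklore] -/
theorem not_stripped_of_not_crux (h : ¬ IsotypicMiddleClassesAlgebraic) :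
    ¬ ∀ (μ : OrientationFamily) (m : ℕ) (X : Motives.SchemeOver ℂ)
      (D : UnitaryBallQuotientDatum (2 * (m + 1)) X) (γ : complexBetti (X ⊗ X) (2 * (2 * (m + 1)))),
      (∀ β, IsOfHodgeType (2 * (m + 1)) X (2 * (m + 1)) (m + 1) (m + 1)
        (corrAction μ D.isSmoothProjective D.isSmoothProjective
          (rfl : 2 * (m + 1) + 2 * (2 * (m + 1)) = 2 * (m + 1) + 2 * (2 * (m + 1))) γ β)) →
      ∀ c, IsRationalClass c →
        corrAction μ D.isSmoothProjective D.isSmoothProjective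
          (rfl : 2 * (m + 1) + 2 * (2 * (m + 1)) = 2 * (m + 1) + 2 * (2 * (m + 1))) γ c = c →
        c ∈ algebraicClasses X (m + 1) := by
  intro hS
  refine h ?_
  intro μ _ m X D _ _ γ _ P _ hP c hc hPc
  exact hS μ m X D γ hP c hc hPc

end Summit.HodgeConjecture.HodgeConjecture.Theorems.IsotypicMiddleClassesAlgebraic.Negative.LoadBearing

end
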